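import Mathlib
import Summits.Ventures.HSemireg.ApolarGramHankel

/-!
# Venture HSemireg — apolar Gram matrix: circulants, the DFT, and the cot configuration

HONEST FRAMING. Finite-dimensional linear algebra, the discrete Fourier transform on `ZMod N` and
elementary trigonometry only; no variety / sheaf / semiregularity map; nothing here says that
HC / HC_CM / HC_AV holds; no Literature fact is declared or assumed.

Third file of the apolar chain (cell pub-hsemireg, FORMULA-N PART A §2.9 =
theory/th6/apolar/APOLAR-GRAM-RANK-th6g8.md §1 (d)): the REFERENCE CONFIGURATION for the sign of
`det ((x_i − x_j)^n)` at odd `ρ`.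

* `det_circulant_eq_prod_dft` — `det (circulant v) = ∏_k 𝓕 v k` on `ZMod N` (Mathlib's `ZMod.dft`;
  `circulant v · F = F · diag(𝓕 v)` for the Fourier matrix `F`, and `F F̄ = N · 1`).
* `det_circulant_pos` — `N` odd, `v` real and even, `det ≠ 0`, `Σ v > 0` ⇒ `det (circulant v) > 0`
  (the real DFT values pair off `λ(−k) = λ(k)`; `prod_pos_of_even_odd`).
* the cot configuration `cotConfig k` (`x_j = −cot(π(2j+1)/(2(k+1)))`, `k + 1` equally spaced
  points of `RP¹` read in the affine chart; `cotConfig_strictMono`), `gram_cotConfig_eq`: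
  `G_n = D · circulant(sin^n(π m/(k+1))) · D` with `D = diag((sin θ_j)^{−n}) > 0` (`n` even), and
  `det_gram_cotConfig_pos`: for `k + 1` odd ≥ 3 and `det ≠ 0`, `det G_n(cot configuration) > 0`.
-/

noncomputable section

open Matrix Finset ZMod
open scoped BigOperators

namespace Summit.Ventures.HSemireg.ApolarGram

variable {N : ℕ} [NeZero N]

/-- the Fourier matrix `F_{jk} = e(jk/N)`. -/
def fourierMat (N : ℕ) [NeZero N] : Matrix (ZMod N) (ZMod N) ℂ :=
  Matrix.of fun j k => (stdAddChar (j * k) : ℂ)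

/-- the conjugate Fourier matrix `F'_{jk} = e(−jk/N)`. -/
def fourierMat' (N : ℕ) [NeZero N] : Matrix (ZMod N) (ZMod N) ℂ :=
  Matrix.of fun j k => (stdAddChar (-(j * k)) : ℂ)

/-- orthogonality of characters: `Σ_i e(t i) = N [t = 0]`. -/
theorem sum_stdAddChar_mul (t : ZMod N) :
    ∑ i : ZMod N, (stdAddChar (t * i) : ℂ) = if t = 0 then (N : ℂ) else 0 := by
  split_ifs with h
  · simp only [h, zero_mul, AddChar.map_zero_eq_one, sum_const, card_univ, ZMod.card, nsmul_eq_mul,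
      mul_one]
  · exact AddChar.sum_eq_zero_of_ne_one (isPrimitive_stdAddChar N h)

/-- `F F' = N • 1`. -/
theorem fourierMat_mul_fourierMat' : fourierMat N * fourierMat' N = (N : ℂ) • (1 : Matrix (ZMod N) (ZMod N) ℂ) := by
  ext j k
  simp only [fourierMat, fourierMat', Matrix.mul_apply, Matrix.of_apply, Matrix.smul_apply,
    Matrix.one_apply, smul_eq_mul, mul_ite, mul_one, mul_zero]
  have : ∀ i : ZMod N, (stdAddChar (j * i) : ℂ) * stdAddChar (-(i * k)) = stdAddChar ((j - k) * i) := by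
    intro i
    rw [← AddChar.map_add_eq_mul]
    congr 1; ring
  simp_rw [this, sum_stdAddChar_mul, sub_eq_zero]

/-- `det F ≠ 0`. -/
theorem det_fourierMat_ne_zero : (fourierMat N).det ≠ 0 := by
  intro h
  have h2 := congrArg Matrix.det (fourierMat_mul_fourierMat' (N := N))
  rw [Matrix.det_mul, h, zero_mul, Matrix.det_smul, Matrix.det_one, mul_one, ZMod.card] at h2
  exact pow_ne_zero _ (Nat.cast_ne_zero.2 (NeZero.ne N)) h2.symm

/-- the circulant acts diagonally on the Fourier matrix: `circulant v · F = F · diag(𝓕 v)`. -/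
theorem circulant_mul_fourierMat (v : ZMod N → ℂ) :
    Matrix.circulant v * fourierMat N = fourierMat N * Matrix.diagonal (𝓕 v) := by
  ext j k
  rw [Matrix.mul_diagonal, Matrix.mul_apply]
  simp only [Matrix.circulant_apply, fourierMat, Matrix.of_apply, dft_apply, smul_eq_mul,
    Finset.mul_sum]
  -- reindex l ↦ m := j − l
  rw [← Equiv.sum_comp (Equiv.subLeft j)]
  refine Finset.sum_congr rfl fun m _ => ?_
  simp only [Equiv.subLeft_apply, sub_sub_cancel]
  rw [mul_comm (v m), ← mul_assoc, ← AddChar.map_add_eq_mul]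
  congr 2; ring

/-- **det (circulant v) = ∏_k 𝓕 v k.** -/
theorem det_circulant_eq_prod_dft (v : ZMod N → ℂ) :
    (Matrix.circulant v).det = ∏ k, 𝓕 v k := by
  have h := congrArg Matrix.det (circulant_mul_fourierMat v)
  rw [Matrix.det_mul, Matrix.det_mul, Matrix.det_diagonal, mul_comm] at h
  exact mul_left_cancel₀ det_fourierMat_ne_zero h

end Summit.Ventures.HSemireg.ApolarGram

namespace Summit.Ventures.HSemireg.ApolarGram

open Matrix Finset ZMod
open scoped BigOperators ComplexConjugate

variable {N : ℕ} [NeZero N]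

/-- `conj e(x) = e(−x)`. -/
theorem conj_stdAddChar (x : ZMod N) : conj (stdAddChar x : ℂ) = stdAddChar (-x) := by
  rw [stdAddChar_apply, stdAddChar_apply, AddChar.map_neg_eq_inv, Circle.coe_inv_eq_conj]

/-- `conj (𝓕 v k) = 𝓕 v (−k)` for a real sequence. -/
theorem conj_dft_real (v : ZMod N → ℝ) (k : ZMod N) :
    conj (𝓕 (fun m => (v m : ℂ)) k) = 𝓕 (fun m => (v m : ℂ)) (-k) := by
  rw [dft_apply, dft_apply, map_sum]
  refine Finset.sum_congr rfl fun m _ => ?_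
  rw [smul_eq_mul, smul_eq_mul, map_mul, conj_stdAddChar, Complex.conj_ofReal, mul_neg, neg_neg]

/-- for a real EVEN sequence the DFT values are real. -/
theorem dft_eq_re_of_even (v : ZMod N → ℝ) (hv : ∀ m, v (-m) = v m) (k : ZMod N) :
    𝓕 (fun m => (v m : ℂ)) k = ((𝓕 (fun m => (v m : ℂ)) k).re : ℂ) := by
  have heven : Function.Even (fun m => (v m : ℂ)) := fun m => by simp [hv m]
  have hF := (dft_even_iff.2 heven) k   -- 𝓕 v (-k) = 𝓕 v k
  have hc : conj (𝓕 (fun m => (v m : ℂ)) k) = 𝓕 (fun m => (v m : ℂ)) k := by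
    rw [conj_dft_real, hF]
  exact (Complex.conj_eq_iff_re.1 hc).symm

/-- `det (circulant v) = ∏_k re (𝓕 v k)` for a real even sequence. -/
theorem det_circulant_real_even (v : ZMod N → ℝ) (hv : ∀ m, v (-m) = v m) :
    (Matrix.circulant v).det = ∏ k, (𝓕 (fun m => (v m : ℂ)) k).re := by
  have h1 : ((Matrix.circulant v).det : ℂ) = (Matrix.circulant fun m => (v m : ℂ)).det := by
    have h := Complex.ofRealHom.map_det (Matrix.circulant v)
    rw [Complex.ofRealHom_eq_coe] at h
    rw [h, RingHom.mapMatrix_apply, Matrix.map_circulant]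
    rfl
  apply Complex.ofReal_injective
  rw [h1, det_circulant_eq_prod_dft, Complex.ofReal_prod]
  exact Finset.prod_congr rfl fun k _ => dft_eq_re_of_even v hv k

/-- pairing lemma: on `ZMod N`, `N` odd, an even real function with `f 0 > 0` and no zero has
positive product (the values at `k ≠ 0` pair off as squares). -/
theorem prod_pos_of_even_odd (hN : Odd N) (f : ZMod N → ℝ) (heven : ∀ k, f (-k) = f k)
    (hne : ∀ k, f k ≠ 0) (h0 : 0 < f 0) : 0 < ∏ k, f k := by
  classical
  obtain ⟨u, hu⟩ := hN
  -- half system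
  let S : Finset (ZMod N) := univ.filter fun k => 1 ≤ k.val ∧ k.val ≤ u
  have hval_neg : ∀ k : ZMod N, k ≠ 0 → (-k).val = N - k.val := by
    intro k hk; rw [ZMod.neg_val, if_neg hk]
  have hmemS : ∀ k : ZMod N, k ∈ S ↔ 1 ≤ k.val ∧ k.val ≤ u := fun k => by
    simp [S]
  have hsplit : (univ : Finset (ZMod N)).erase 0 = S ∪ S.image Neg.neg := by
    ext k
    rw [mem_erase, mem_union, mem_image, hmemS]
    constructor
    · rintro ⟨hk, -⟩
      have hkv : 1 ≤ k.val := Nat.one_le_iff_ne_zero.2 (fun h => hk ((ZMod.val_eq_zero k).1 h))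
      have hlt : k.val < N := ZMod.val_lt k
      by_cases hle : k.val ≤ u
      · exact Or.inl ⟨hkv, hle⟩
      · refine Or.inr ⟨-k, ?_, neg_neg k⟩
        rw [hmemS, hval_neg k hk]
        omega
    · rintro (⟨h1, -⟩ | ⟨k', hk', rfl⟩)
      · refine ⟨fun h => ?_, mem_univ _⟩
        rw [h, ZMod.val_zero] at h1; omega
      · rw [hmemS] at hk'
        refine ⟨fun h => ?_, mem_univ _⟩
        have : k' = 0 := by rw [← neg_neg k', h, neg_zero]
        rw [this, ZMod.val_zero] at hk'; omega
  have hdisj : Disjoint S (S.image Neg.neg) := by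
    rw [Finset.disjoint_left]
    rintro k hk hk'
    rw [hmemS] at hk
    rw [mem_image] at hk'
    obtain ⟨k', hk'S, rfl⟩ := hk'
    rw [hmemS] at hk'S
    have hk'0 : k' ≠ 0 := by intro h; rw [h, ZMod.val_zero] at hk'S; omega
    rw [hval_neg k' hk'0] at hk
    have := ZMod.val_lt k'
    omega
  have hprod : ∏ k, f k = f 0 * ((∏ k ∈ S, f k) * ∏ k ∈ S, f k) := by
    rw [← Finset.mul_prod_erase univ f (mem_univ 0), hsplit, Finset.prod_union hdisj,
      Finset.prod_image fun a _ b _ h => neg_injective h]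
    congr 2
    exact Finset.prod_congr rfl fun k _ => heven k
  rw [hprod]
  have hS_ne : ∏ k ∈ S, f k ≠ 0 := Finset.prod_ne_zero_iff.2 fun k _ => hne k
  exact mul_pos h0 (mul_self_pos.2 hS_ne)

/-- **positivity**: `N` odd, `v` real and even, `det (circulant v) ≠ 0` and `Σ v > 0` ⇒
`det (circulant v) > 0`. -/
theorem det_circulant_pos (hN : Odd N) (v : ZMod N → ℝ) (hv : ∀ m, v (-m) = v m)
    (hne : (Matrix.circulant v).det ≠ 0) (h0 : 0 < ∑ m, v m) : 0 < (Matrix.circulant v).det := by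
  have hdet := det_circulant_real_even v hv
  rw [hdet] at hne ⊢
  have heven : Function.Even (fun m => (v m : ℂ)) := fun m => by simp [hv m]
  refine prod_pos_of_even_odd hN _ (fun k => ?_) (fun k hk => hne (Finset.prod_eq_zero (mem_univ k) hk)) ?_
  · simp only [(dft_even_iff.2 heven) k]
  · rw [dft_apply_zero, ← Complex.ofReal_sum, Complex.ofReal_re]; exact h0

end Summit.Ventures.HSemireg.ApolarGram

open Matrix Finset Real
open scoped BigOperators

namespace Summit.Ventures.HSemireg.ApolarGram


variable (k : ℕ)

/-- angles `θ_j = π (2j+1) / (2(k+1)) ∈ (0, π)`. -/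
def theta (j : Fin (k + 1)) : ℝ := π * (2 * (j : ℕ) + 1) / (2 * (k + 1))

/-- the cot configuration `x_j = −cot θ_j` (increasing). -/
def cotConfig (j : Fin (k + 1)) : ℝ := -(Real.cos (theta k j) / Real.sin (theta k j))

/-- the circulant generator `v_m = sin^n (π m / (k+1))`. -/
def sinSeq (n : ℕ) (m : ZMod (k + 1)) : ℝ := Real.sin (π * (m.val : ℝ) / (k + 1)) ^ n

/-- `0 < θ_j`. -/
theorem theta_pos (j : Fin (k + 1)) : 0 < theta k j := by
  unfold theta; positivity

/-- `θ_j < π`. -/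
theorem theta_lt_pi (j : Fin (k + 1)) : theta k j < π := by
  unfold theta
  have hj : (j : ℕ) < k + 1 := j.isLt
  have h2 : (2 * (j : ℝ) + 1) < 2 * (k + 1) := by
    have : (j : ℝ) + 1 ≤ k + 1 := by exact_mod_cast hj
    linarith
  have hpos : (0 : ℝ) < 2 * (k + 1) := by positivity
  rw [mul_div_assoc]
  calc π * ((2 * (j : ℝ) + 1) / (2 * (k + 1))) < π * 1 := by
        apply mul_lt_mul_of_pos_left _ Real.pi_pos
        rw [div_lt_one hpos]; exact h2
    _ = π := mul_one π

/-- `sin θ_j > 0`. -/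
theorem sin_theta_pos (j : Fin (k + 1)) : 0 < Real.sin (theta k j) :=
  Real.sin_pos_of_pos_of_lt_pi (theta_pos k j) (theta_lt_pi k j)

/-- `θ_i − θ_j = π (i − j)/(k+1)`. -/
theorem theta_sub (i j : Fin (k + 1)) :
    theta k i - theta k j = π * ((i : ℝ) - (j : ℝ)) / (k + 1) := by
  unfold theta
  field_simp
  ring

/-- the angles increase with `j`. -/
theorem theta_strictMono : StrictMono (theta k) := by
  intro i j hij
  have h : (i : ℝ) < (j : ℝ) := by exact_mod_cast hij
  have := theta_sub k j i
  have hpos : 0 < π * ((j : ℝ) - (i : ℝ)) / (k + 1) := by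
    apply div_pos (mul_pos Real.pi_pos (by linarith)) (by positivity)
  linarith

/-- `x_j` is strictly increasing. -/
theorem cotConfig_strictMono : StrictMono (cotConfig k) := by
  intro i j hij
  unfold cotConfig
  have hsi := sin_theta_pos k i
  have hsj := sin_theta_pos k j
  rw [neg_lt_neg_iff, div_lt_div_iff₀ hsj hsi]
  have hlt : theta k i < theta k j := theta_strictMono k hij
  have hsub : 0 < Real.sin (theta k j - theta k i) :=
    Real.sin_pos_of_pos_of_lt_pi (by linarith) (by linarith [theta_lt_pi k j, theta_pos k i])
  rw [Real.sin_sub] at hsub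
  linarith

/-- the difference of two nodes: `x_i − x_j = sin(θ_i − θ_j) / (sin θ_i sin θ_j)`. -/
theorem cotConfig_sub (i j : Fin (k + 1)) :
    cotConfig k i - cotConfig k j =
      Real.sin (theta k i - theta k j) / (Real.sin (theta k i) * Real.sin (theta k j)) := by
  unfold cotConfig
  have hsi := (sin_theta_pos k i).ne'
  have hsj := (sin_theta_pos k j).ne'
  rw [Real.sin_sub]
  field_simp
  ring

/-- defeq test: the circulant on `ZMod (k+1) = Fin (k+1)` read with `Fin` indices. -/
theorem circulant_sinSeq_apply (n : ℕ) (a b : Fin (k + 1)) :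
    (Matrix.circulant (sinSeq k n) : Matrix (Fin (k + 1)) (Fin (k + 1)) ℝ) a b = sinSeq k n (a - b) :=
  rfl

/-- `sin^n (θ_i − θ_j) = v (i − j)` for even `n` (the wrap-around costs a sign, killed by `n` even). -/
theorem sin_theta_sub_pow (n : ℕ) (hn : Even n) (i j : Fin (k + 1)) :
    Real.sin (theta k i - theta k j) ^ n = sinSeq k n (i - j) := by
  rw [theta_sub, sinSeq]
  change Real.sin (π * ((i : ℝ) - (j : ℝ)) / (k + 1)) ^ n =
    Real.sin (π * (((i - j : Fin (k + 1)) : ℕ) : ℝ) / (k + 1)) ^ n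
  rcases le_or_gt j i with hle | hlt
  · rw [Fin.coe_sub_iff_le.2 hle, Nat.cast_sub (Fin.le_iff_val_le_val.1 hle)]
  · rw [Fin.coe_sub_iff_lt.2 hlt]
    have hj : (j : ℕ) < k + 1 := j.isLt
    rw [show ((k + 1 + (i : ℕ) - (j : ℕ) : ℕ) : ℝ) = (k + 1 : ℝ) + ((i : ℝ) - (j : ℝ)) by
      rw [Nat.cast_sub (by omega)]; push_cast; ring]
    rw [show π * ((k + 1 : ℝ) + ((i : ℝ) - (j : ℝ))) / (k + 1) = π * ((i : ℝ) - (j : ℝ)) / (k + 1) + π by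
      field_simp; ring]
    rw [Real.sin_add_pi, hn.neg_pow]

end Summit.Ventures.HSemireg.ApolarGram

namespace Summit.Ventures.HSemireg.ApolarGram

open Matrix Finset Real
open scoped BigOperators

variable (k : ℕ)

/-- `v` is even. -/
theorem sinSeq_neg (n : ℕ) (m : ZMod (k + 1)) : sinSeq k n (-m) = sinSeq k n m := by
  unfold sinSeq
  by_cases hm : m = 0
  · rw [hm, neg_zero]
  · rw [ZMod.neg_val, if_neg hm]
    have hlt : m.val < k + 1 := ZMod.val_lt m
    rw [Nat.cast_sub hlt.le]
    rw [show π * ((((k + 1 : ℕ) : ℝ) - (m.val : ℝ))) / (k + 1) = π - π * (m.val : ℝ) / (k + 1) by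
      push_cast; field_simp]
    rw [Real.sin_pi_sub]

/-- `Σ v > 0` (`k ≥ 1`, i.e. at least two nodes; `n` even). -/
theorem sum_sinSeq_pos (n : ℕ) (hn : Even n) (hk : 1 ≤ k) : 0 < ∑ m, sinSeq k n m := by
  have hnonneg : ∀ m, 0 ≤ sinSeq k n m := fun m => hn.pow_nonneg _
  have h1 : 0 < sinSeq k n 1 := by
    unfold sinSeq
    apply pow_pos
    have hval : ((1 : ZMod (k + 1)).val : ℝ) = 1 := by
      rw [ZMod.val_one'' (by omega)]; simp
    rw [hval, mul_one]
    apply Real.sin_pos_of_pos_of_lt_pi (by positivity)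
    rw [div_lt_iff₀ (by positivity)]
    have : (1 : ℝ) < k + 1 := by
      have : (1 : ℝ) ≤ k := by exact_mod_cast hk
      linarith
    nlinarith [Real.pi_pos]
  calc 0 < sinSeq k n 1 := h1
    _ ≤ ∑ m, sinSeq k n m := Finset.single_le_sum (fun m _ => hnonneg m) (mem_univ _)

/-- the positive diagonal scaling `d_j = (sin θ_j)⁻¹ ^ n`. -/
def dScale (n : ℕ) (j : Fin (k + 1)) : ℝ := (Real.sin (theta k j))⁻¹ ^ n

/-- the scaling is positive. -/
theorem dScale_pos (n : ℕ) (j : Fin (k + 1)) : 0 < dScale k n j :=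
  pow_pos (inv_pos.2 (sin_theta_pos k j)) _

/-- **the congruence**: `G_n(cot configuration) = D · circulant(v) · D`. -/
theorem gram_cotConfig_eq (n : ℕ) (hn : Even n) :
    gram n (cotConfig k) =
      Matrix.diagonal (dScale k n) * (Matrix.circulant (sinSeq k n) : Matrix (Fin (k + 1)) (Fin (k + 1)) ℝ) *
        Matrix.diagonal (dScale k n) := by
  ext i j
  rw [Matrix.mul_diagonal, Matrix.diagonal_mul, circulant_sinSeq_apply, ← sin_theta_sub_pow k n hn,
    gram, Matrix.of_apply, cotConfig_sub, dScale, dScale, div_eq_mul_inv, mul_pow, mul_inv, mul_pow]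
  ring

/-- `det G_n(cot configuration) = (∏ d)² · det circulant(v)`. -/
theorem det_gram_cotConfig (n : ℕ) (hn : Even n) :
    (gram n (cotConfig k)).det =
      (∏ j, dScale k n j) * (Matrix.circulant (sinSeq k n)).det * ∏ j, dScale k n j := by
  rw [gram_cotConfig_eq k n hn, Matrix.det_mul, Matrix.det_mul, Matrix.det_diagonal]
  rfl

/-- **reference sign**: if `G_n` of the cot configuration with `k + 1` odd ≥ 3 nodes is
non-singular, its determinant is POSITIVE. -/
theorem det_gram_cotConfig_pos (n : ℕ) (hn : Even n) (hk : Even k) (hk1 : 1 ≤ k)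
    (hdet : (gram n (cotConfig k)).det ≠ 0) : 0 < (gram n (cotConfig k)).det := by
  have hD : 0 < ∏ j, dScale k n j := Finset.prod_pos fun j _ => dScale_pos k n j
  rw [det_gram_cotConfig k n hn] at hdet ⊢
  have hC : (Matrix.circulant (sinSeq k n)).det ≠ 0 := by
    intro h; apply hdet; rw [h, mul_zero, zero_mul]
  have hodd : Odd (k + 1) := hk.add_one
  have hpos := det_circulant_pos hodd (sinSeq k n) (sinSeq_neg k n) hC (sum_sinSeq_pos k n hn hk1)
  positivity

end Summit.Ventures.HSemireg.ApolarGram
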